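/-
Copyright (c) 2026 the pub-hodgecm-mathlib formalisation cell (harness21).  Seat hodgecm-mathlib-F0P3a-p01 (g30) (author of the HOME proof, law socket §4): heir LEAD
F0P3a-plan (g19) T18-06 (R-16) ORDER «RC-1» — ★ #11 `F0P3cDyRamAnchorRowsOfFourFrameLaws` (port B-p08 (g41)) RE-PROVED over the schedule-parametrised defs of №1-R ∕ №2c-R.  2026-09-03.
-/
import Summits.HodgeConjecture.HodgeConjecture.Theorems.F0P3cDyRamFourFrameLawDefsR        -- ★ DEFS LEAF №1 «LAW-DEFS» (dealer g10; filed LH4-p03): `StableLawAt`, `KappaAmplitudeLawAt`, `KappaSignLawAt`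
                                                                                          -- (the place-wise cuts (S1) of SIGSHEET v2 §S∕§K); brings ★ #0a `UnitaryThreeFourFrameDefs`
import Summits.HodgeConjecture.HodgeConjecture.Theorems.F0P3cDyRamFourFrameDictionaryDefs  -- ★ DEFS LEAF №2b «DICTIONARY» : (D-G) `AnchorCountDictionary`
import Summits.HodgeConjecture.HodgeConjecture.Theorems.F0P3cDyRamFourFrameHSideDefsR      -- ★ DEFS LEAF №2c v2 «H-SIDE» (8297081aa343bca6): (D-CΔ) `FourFrameTransferFactor`, (D-H) `HSideAnchorRows`
import HarnessLib

/-!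
# RC-1 (LEAD T18-06 (R-16)) SCHEDULE VERSION of ★ #11: the SAME joint with the κ-cuts `KappaAmplitudeLawAtS ∕ KappaSignLawAtS shift N₀ τ` (№1-R) and the dictionaries
# `FourFrameTransferFactorS shift N₀` ∕ `HSideAnchorRowsS shift N₀ τ tv` (№2c-R) — `shift := shiftT` is ★ #11 token for token, `shift := shiftR` the re-cut; the PROOF is ★ #11's byte for byte.  RISK LINE (LEAD T18-07 (1), verbatim): «t-free token fitted on ONE d < t cell (e2c); d = 2∕4 at t = 6 (e3a, req629) pending».

# Crux `H413`, line LH4 «(D-RAM) FOUR-FRAME» road, STAGE 1a — THE LAW SOCKET PROPER (GATE 1a-1 §4, ★-grade): the type-(1) population row of the anchor piece `1_{K_t}`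
# from the place-wise four-frame laws + the three dictionaries (★ tree twin of `F0/P3a/F0P3a-p01/g30/LAWSOCKET-DRAM-FourFrame.v1_5.F0P3ap01g30.lean` 481abd786a36bbea §4; deal g10-#11)

Cell `hodgecm-mathlib` (D-0151), FLOOR 0, crux item H413 = `stmt-HodgeConjecture-24833`, route of record `HCCMUnconditional`; squad F0∕P3c∕LH4 (req618, director s1808),
dealer LH4-plan (g10) WORD #5 (d) deal g10-#11; heir LEAD F0P3a-plan DIRECTIVE v1.1 d3f1616d0136e728 (R-5) «GATE 1a-1 = letter (L-B): … §4 `typeOneRow_anchor_of_fourFrameLaws`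
(PROVED v1.1)», (R-6) «rows share ψ» (v1.3), T17-29∕T17-34; author of the HOME proof F0P3a-p01 (g30), port B-p08 (g41).  THEOREMS ONLY (one theorem; no `def`, no instance, no
notation, no `sorry`); imports = ★ №1 `Theorems/F0P3cDyRamFourFrameLawDefs.lean` + ★ №2b `…DictionaryDefs.lean` + ★ №2c `…HSideDefs.lean` + HarnessLib; lane `--supports
stmt-HodgeConjecture-24833 --as helper` (count-neutral).  Default heartbeats (the HOME file's 800 000-heartbeat cap is NOT needed against the ★ leaves and is dropped — no waiver).  PORT NOTE: the two binders `(S)At` ∕ `(K-ABS)At` are kept in the statement exactly as typed by p01 («booked: (S)At fixes `C`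
against the stable side; not needed for the row itself») but renamed `_hS` ∕ `_hKA` because the proof does not use them (tree lint); binder TYPES unchanged.

WHAT IS PROVED.  `anchorRows_of_fourFrameLaws` — at a wild ramified non-split place `w ∣ v` of the CM field `L` (datum exponents `(d, t_E)`, `IsRamifiedQuadraticDatum σ_w ϖ d t_E`,
a skew element `δ`), GIVEN the place-wise cuts (S)At, (K-ABS)At, (K-SGN)At of SIGSHEET v2 (★ №1), the census dictionary (D-G) `AnchorCountDictionary tv` (★ №2b), the norm-pair ∕
relative-transfer-factor dictionary (D-CΔ) `FourFrameTransferFactor N₀` and the H-side realisation (D-H) `HSideAnchorRows N₀ τ tv` (★ №2c), for every unitary `μ` of the letter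
and the canonical orbital families: the TYPE-(1) CLAUSE of ★ `localTransferAtOne_of_populations` holds for the anchor `g = 1_{K_tv}` (the indicator of `Kt` = the stabiliser of a
type-`tv` vertex lattice `N`, `tv ∈ {0, 2}`; its census constant `C` comes from (D-G)), `T = Δ‴_v[μ]`, with ONE finite smooth `H`-family `ψ` and coefficients shared by the three rows ((R-6)), and rows (2)(3) as delivered
by (D-H).  PROOF (p01 (g30), carried verbatim): the `Σᶠ` over `G`-classes is supported on the four norm-pair classes `[t_b]` by (D-CΔ)(C) and ★ `TransferFactorData.eq_zero_of_not_rel`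
∕ `conj_right`; each term factors as `Δ‴(γ_H, t_{b₀})·κ_i(b) · C·n_tv(Γ_b)` ((D-CΔ)(Δ), (D-G)); the κ-weighted four-frame sum is evaluated by (K-SGN)At; (D-H) supplies the right side.

HONEST LABEL.  Count-neutral: every antecedent is STAGE-1 debt — the three census laws are PROVER TARGETS (never facts), the dictionaries (D-G)(D-CΔ)(D-H) are tier-1 units
U2G∕U2H; the verdict of record for (D-RAM) stays PRINT [LanglandsShelstad1989 Thm. p. 484 ∕ Rogawski1990 Prop. 4.9.1 (a)] ∕ XL; `HC_CM` is proved only modulo the 7 printed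
citations (2 remaining: hLiu418 = `stmt-HodgeConjecture-24832`, h413 = `stmt-HodgeConjecture-24833`) until rung 0 closes.

## References
* [Rogawski1990] J. D. Rogawski, *Automorphic Representations of Unitary Groups in Three Variables*, Ann. of Math. Stud. 123 (1990): §4.9 Prop. 4.9.1 (a) p. 55; §8.1 Prop.
  8.1.2 (b) p. 113, p. 116 (germ expansion, the constant term).
* [LanglandsShelstad1989] R. P. Langlands, D. Shelstad, *Orbital integrals on forms of SL(3), II*, Canad. J. Math. 41 (1989) 480–507: §1 (local transfer factors), Theorem p. 484.
* [Hales1992] T. C. Hales, *Unipotent representations and unipotent classes in SL(n)* ∕ the subregular germ, Thm. 5.6 p. 129 (the κ-subregular germ reading of (K-ABS)).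
-/

noncomputable section

namespace Summit.HodgeConjecture.HodgeConjecture.Cruxes.H413.F0P3cDyRamAnchorRowsOfFourFrameLawsR

open MeasureTheory Measure NumberField IsDedekindDomain Topology Filter
open Literature.NumberTheory.Automorphic Literature.NumberTheory.Automorphic.UnitaryGroup Literature.NumberTheory.Automorphic.IntegralReduction
open Literature.NumberTheory.Automorphic.UnitaryLatticeTree Literature.NumberTheory.Automorphic.HermitianLattice
open Literature.NumberTheory.Rogawski1990 Literature.NumberTheory.GaloisRepresentations
open Literature.MeasureTheory.Group (descConj)
open scoped Matrix MatrixGroups Classical ValuativeRel WithZero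
open Literature.NumberTheory.Automorphic.UnitaryThreeFourFrame
open Summit.HodgeConjecture.HodgeConjecture.Cruxes.H413.F0P3cDyRamFourFrameLawDefs
open Summit.HodgeConjecture.HodgeConjecture.Cruxes.H413.F0P3cDyRamFourFrameLawDefsR
open Summit.HodgeConjecture.HodgeConjecture.Cruxes.H413.F0P3cDyRamFourFrameDictionaryDefs
open Summit.HodgeConjecture.HodgeConjecture.Cruxes.H413.F0P3cDyRamFourFrameHSideDefs
open Summit.HodgeConjecture.HodgeConjecture.Cruxes.H413.F0P3cDyRamFourFrameHSideDefsR

/-- **§4 · `anchorRows_of_fourFrameLaws` — THE THREE POPULATION ROWS OF THE ANCHOR PIECE `1_{K_t}`, ONE SHARED H-FAMILY; ROW (1) FROM THE FOUR-FRAME LAWS (v1.3, (R-6)).**  At a wild ramified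
non-split place with datum exponents `(d, t_E)`, GIVEN: the place-wise cuts (S)At, (K-ABS)At, (K-SGN)At of SIGSHEET v2 (§1); the census dictionary (D-G) for the type-`tv`
anchor; the norm-pair ∕ relative-transfer-factor dictionary (D-CΔ); and the H-side realisation (D-H) — the TYPE-(1) CLAUSE `h₁` of ★ `localTransferAtOne_of_populations`
holds for `g = 1_{K_tv}`, `T = Δ‴_v[μ]`, the canonical `mG₃`, with SOME finite smooth H-family `ψ` and coefficients.  CONSUMPTION (f2′): (S)At — at `1_{K_tv}`, not needed
for the row itself (booked: it fixes `C` against the stable side ∕ unit (iii)'s normalisation); (K-ABS)At + (K-SGN)At — at `1_{K_tv}`, type-(1) `γ_H`, slot `i` of `γ_H`: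
they evaluate `Σ_b κ_i(b)Φ(1_{K_tv}, [t_b])` (§3 + sign); (D-G) once per literal `t_b`; (D-CΔ) once per `γ_H`; (D-H) once per place.  BODY
— PROVED (v1.1): `Σᶠ` over classes ↦ the four norm-pair classes by (D-CΔ)(C) and ★ `TransferFactorData.eq_zero_of_not_rel`∕`conj_right`; factor `Δ‴(γ_H, t_{b₀})` by (D-CΔ)(Δ);
(D-G) at each literal; (K-SGN)At for the signed value; (D-H) for the right side. -/
theorem anchorRows_of_fourFrameLawsS (shift : ℕ → ℕ → ℤ)
    (L : Type) [Field L] [NumberField L] [IsCMField L]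
      {v : HeightOneSpectrum (𝓞 ↥(maximalRealSubfield L))} (w : UnitaryGroup.PlacesOver L v)
      (hw : IsCMField.complexConj L • w.1 = w.1) (_he : v.asIdeal.ramificationIdx' w.1.asIdeal ≠ 1)
      (_h2 : ¬ IsUnit (2 : 𝒪[w.1.adicCompletion L]))
      (ϖ : (w.1.adicCompletion L)) (_hϖ : Valued.v ϖ = WithZero.exp (-1 : ℤ))
      [Fintype (Valued.ResidueField (w.1.adicCompletion L))] (d tE : ℕ) (hD : IsRamifiedQuadraticDatum (galAdicCompletionMap (L := L) (IsCMField.complexConj L) hw) ϖ d tE) (N₀ : ℕ → ℕ) (τ : ℕ → ℤ)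
      (δ : (w.1.adicCompletion L)) (hδ : (galAdicCompletionMap (L := L) (IsCMField.complexConj L) hw) δ = -δ) (hδ0 : δ ≠ 0)
      -- (iii) the three laws of SIGSHEET v2, cut place-wise (§1), AT this datum
      (_hS : StableLawAt N₀ (galAdicCompletionMap (L := L) (IsCMField.complexConj L) hw) ϖ d tE) (_hKA : KappaAmplitudeLawAtS shift N₀ τ (galAdicCompletionMap (L := L) (IsCMField.complexConj L) hw) ϖ d tE) (hKS : KappaSignLawAtS shift N₀ τ (galAdicCompletionMap (L := L) (IsCMField.complexConj L) hw) ϖ d tE)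
      -- the NEW dictionaries (§2)
      (tv : ℕ) (htv : tv = 0 ∨ tv = 2)
      (hDG : AnchorCountDictionary tv) (hDΔ : FourFrameTransferFactorS shift N₀) (hDH : HSideAnchorRowsS shift N₀ τ tv)
      -- the letter's `μ`, the measurability data, the canonical families
      (μ : HeckeCharacter L) (hμu : μ.IsUnitary)
      (hμω : ∀ x : ideleGroup ↥(maximalRealSubfield L), μ (AdeleRing.ideleBaseChange ↥(maximalRealSubfield L) L x) = quadraticHeckeCharCM L x)
      [MeasurableSpace ((UnitaryGroup.cmDatum L 3 (Matrix.of fun i j : Fin 3 => if i.val + j.val + 1 = 3 then (1 : L) else 0)).Local v)] [BorelSpace ((UnitaryGroup.cmDatum L 3 (Matrix.of fun i j : Fin 3 => if i.val + j.val + 1 = 3 then (1 : L) else 0)).Local v)]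
      [∀ γ : ((UnitaryGroup.cmDatum L 3 (Matrix.of fun i j : Fin 3 => if i.val + j.val + 1 = 3 then (1 : L) else 0)).Local v), MeasurableSpace (((UnitaryGroup.cmDatum L 3 (Matrix.of fun i j : Fin 3 => if i.val + j.val + 1 = 3 then (1 : L) else 0)).Local v) ⧸ Subgroup.centralizer ({γ} : Set ((UnitaryGroup.cmDatum L 3 (Matrix.of fun i j : Fin 3 => if i.val + j.val + 1 = 3 then (1 : L) else 0)).Local v)))]
      [∀ γ : ((UnitaryGroup.cmDatum L 3 (Matrix.of fun i j : Fin 3 => if i.val + j.val + 1 = 3 then (1 : L) else 0)).Local v), BorelSpace (((UnitaryGroup.cmDatum L 3 (Matrix.of fun i j : Fin 3 => if i.val + j.val + 1 = 3 then (1 : L) else 0)).Local v) ⧸ Subgroup.centralizer ({γ} : Set ((UnitaryGroup.cmDatum L 3 (Matrix.of fun i j : Fin 3 => if i.val + j.val + 1 = 3 then (1 : L) else 0)).Local v)))]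
      [MeasurableSpace ((UnitaryGroup.cmDatum L 2 (Matrix.of fun i j : Fin 2 => if i.val + j.val + 1 = 2 then (1 : L) else 0)).Local v × (UnitaryGroup.cmDatum L 1 (Matrix.of fun i j : Fin 1 => if i.val + j.val + 1 = 1 then (1 : L) else 0)).Local v)] [BorelSpace ((UnitaryGroup.cmDatum L 2 (Matrix.of fun i j : Fin 2 => if i.val + j.val + 1 = 2 then (1 : L) else 0)).Local v × (UnitaryGroup.cmDatum L 1 (Matrix.of fun i j : Fin 1 => if i.val + j.val + 1 = 1 then (1 : L) else 0)).Local v)]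
      [∀ a : ((UnitaryGroup.cmDatum L 2 (Matrix.of fun i j : Fin 2 => if i.val + j.val + 1 = 2 then (1 : L) else 0)).Local v × (UnitaryGroup.cmDatum L 1 (Matrix.of fun i j : Fin 1 => if i.val + j.val + 1 = 1 then (1 : L) else 0)).Local v), MeasurableSpace (((UnitaryGroup.cmDatum L 2 (Matrix.of fun i j : Fin 2 => if i.val + j.val + 1 = 2 then (1 : L) else 0)).Local v × (UnitaryGroup.cmDatum L 1 (Matrix.of fun i j : Fin 1 => if i.val + j.val + 1 = 1 then (1 : L) else 0)).Local v) ⧸ Subgroup.centralizer ({a} : Set ((UnitaryGroup.cmDatum L 2 (Matrix.of fun i j : Fin 2 => if i.val + j.val + 1 = 2 then (1 : L) else 0)).Local v × (UnitaryGroup.cmDatum L 1 (Matrix.of fun i j : Fin 1 => if i.val + j.val + 1 = 1 then (1 : L) else 0)).Local v)))]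
      [∀ a : ((UnitaryGroup.cmDatum L 2 (Matrix.of fun i j : Fin 2 => if i.val + j.val + 1 = 2 then (1 : L) else 0)).Local v × (UnitaryGroup.cmDatum L 1 (Matrix.of fun i j : Fin 1 => if i.val + j.val + 1 = 1 then (1 : L) else 0)).Local v), BorelSpace (((UnitaryGroup.cmDatum L 2 (Matrix.of fun i j : Fin 2 => if i.val + j.val + 1 = 2 then (1 : L) else 0)).Local v × (UnitaryGroup.cmDatum L 1 (Matrix.of fun i j : Fin 1 => if i.val + j.val + 1 = 1 then (1 : L) else 0)).Local v) ⧸ Subgroup.centralizer ({a} : Set ((UnitaryGroup.cmDatum L 2 (Matrix.of fun i j : Fin 2 => if i.val + j.val + 1 = 2 then (1 : L) else 0)).Local v × (UnitaryGroup.cmDatum L 1 (Matrix.of fun i j : Fin 1 => if i.val + j.val + 1 = 1 then (1 : L) else 0)).Local v)))]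
      (νH : Measure ((UnitaryGroup.cmDatum L 2 (Matrix.of fun i j : Fin 2 => if i.val + j.val + 1 = 2 then (1 : L) else 0)).Local v × (UnitaryGroup.cmDatum L 1 (Matrix.of fun i j : Fin 1 => if i.val + j.val + 1 = 1 then (1 : L) else 0)).Local v)) [νH.IsHaarMeasure] [νH.IsMulRightInvariant]
      (νG₃ : Measure ((UnitaryGroup.cmDatum L 3 (Matrix.of fun i j : Fin 3 => if i.val + j.val + 1 = 3 then (1 : L) else 0)).Local v)) [νG₃.IsHaarMeasure] [νG₃.IsMulRightInvariant]
      (mH : OrbitalMeasureFamily ((UnitaryGroup.cmDatum L 2 (Matrix.of fun i j : Fin 2 => if i.val + j.val + 1 = 2 then (1 : L) else 0)).Local v × (UnitaryGroup.cmDatum L 1 (Matrix.of fun i j : Fin 1 => if i.val + j.val + 1 = 1 then (1 : L) else 0)).Local v)) (mG₃ : OrbitalMeasureFamily ((UnitaryGroup.cmDatum L 3 (Matrix.of fun i j : Fin 3 => if i.val + j.val + 1 = 3 then (1 : L) else 0)).Local v))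
      (hmH : mH.IsCanonical (IsLocalGRegular L v) νH) (hmG : mG₃.IsCanonical (fun γ => IsRegularElt (γ.val : GL (Fin 3) (UnitaryGroup.LocalRing L v))) νG₃)
      -- the anchor: the stabiliser of a type-`tv` vertex lattice
      (N : Submodule (Valued.integer (w.1.adicCompletion L)) (Fin 3 → (w.1.adicCompletion L))) (hN : IsVertexLattice (galAdicCompletionMap (L := L) (IsCMField.complexConj L) hw) ϖ ((StdForm.antidiagonal 3).over (w.1.adicCompletion L)) tv N)
      (Kt : Subgroup ((UnitaryGroup.cmDatum L 3 (Matrix.of fun i j : Fin 3 => if i.val + j.val + 1 = 3 then (1 : L) else 0)).Local v)) (hKt : ∀ u : ((UnitaryGroup.cmDatum L 3 (Matrix.of fun i j : Fin 3 => if i.val + j.val + 1 = 3 then (1 : L) else 0)).Local v), u ∈ Kt ↔ mapGL ((localNonsplitEquiv (IsCMField.complexConj L) (Matrix.of fun i j : Fin 3 => if i.val + j.val + 1 = 3 then (1 : L) else 0) (IsCMField.complexConj_ne_one L) w hw u :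
              ↥(unitaryGroupOfForm (galAdicCompletionMap (L := L) (IsCMField.complexConj L) hw) (placeForm (Matrix.of fun i j : Fin 3 => if i.val + j.val + 1 = 3 then (1 : L) else 0) w.1))) : GL (Fin 3) (w.1.adicCompletion L)) N = N)
      (g : ((UnitaryGroup.cmDatum L 3 (Matrix.of fun i j : Fin 3 => if i.val + j.val + 1 = 3 then (1 : L) else 0)).Local v) → ℂ) (hg : g = (Set.indicator (Kt : Set ((UnitaryGroup.cmDatum L 3 (Matrix.of fun i j : Fin 3 => if i.val + j.val + 1 = 3 then (1 : L) else 0)).Local v)) (fun _ => (1 : ℂ)))) :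
    ∃ (r : ℕ) (ψ : Fin r → ((UnitaryGroup.cmDatum L 2 (Matrix.of fun i j : Fin 2 => if i.val + j.val + 1 = 2 then (1 : L) else 0)).Local v × (UnitaryGroup.cmDatum L 1 (Matrix.of fun i j : Fin 1 => if i.val + j.val + 1 = 1 then (1 : L) else 0)).Local v) → ℂ) (_ : ∀ s, IsLocSmooth (ψ s)) (a : Fin r → ℂ),
      (∃ V ∈ 𝓝 (1 : ((UnitaryGroup.cmDatum L 2 (Matrix.of fun i j : Fin 2 => if i.val + j.val + 1 = 2 then (1 : L) else 0)).Local v × (UnitaryGroup.cmDatum L 1 (Matrix.of fun i j : Fin 1 => if i.val + j.val + 1 = 1 then (1 : L) else 0)).Local v)), ∀ γH ∈ V, IsLocalGRegular L v γH →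
        (∃ x : (w.1.adicCompletion L), (((((γH).1.val : GL (Fin 2) (UnitaryGroup.LocalRing L v)).val.map (Pi.evalRingHom (fun w' : UnitaryGroup.PlacesOver L v => w'.1.adicCompletion L) w))).charpoly).IsRoot x) →
        ¬ (∃ (y : ((UnitaryGroup.cmDatum L 2 (Matrix.of fun i j : Fin 2 => if i.val + j.val + 1 = 2 then (1 : L) else 0)).Local v × (UnitaryGroup.cmDatum L 1 (Matrix.of fun i j : Fin 1 => if i.val + j.val + 1 = 1 then (1 : L) else 0)).Local v)) (d' : Fin 2 → (UnitaryGroup.LocalRing L v)ˣ),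
            glDiagonal 2 (UnitaryGroup.LocalRing L v) d' = ((y * γH * y⁻¹).1.val : GL (Fin 2) (UnitaryGroup.LocalRing L v))) →
        ∑ᶠ c : ConjClasses ((UnitaryGroup.cmDatum L 3 (Matrix.of fun i j : Fin 3 => if i.val + j.val + 1 = 3 then (1 : L) else 0)).Local v), ((finExplicitCollection L (Matrix.of fun i j : Fin 3 => if i.val + j.val + 1 = 3 then (1 : L) else 0) μ (finExplicitDelta_conj_left_all L (Matrix.of fun i j : Fin 3 => if i.val + j.val + 1 = 3 then (1 : L) else 0) μ) (finExplicitDelta_conj_right_all L (Matrix.of fun i j : Fin 3 => if i.val + j.val + 1 = 3 then (1 : L) else 0) μ)) v).Δ γH (Quotient.out c) * classOrbitalIntegral mG₃ g c =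
          ∑ s, a s * stableOrbitalIntegralRel (IsLocalStablyConjH L v) mH (ψ s) γH) ∧
      (∃ V ∈ 𝓝 (1 : ((UnitaryGroup.cmDatum L 2 (Matrix.of fun i j : Fin 2 => if i.val + j.val + 1 = 2 then (1 : L) else 0)).Local v × (UnitaryGroup.cmDatum L 1 (Matrix.of fun i j : Fin 1 => if i.val + j.val + 1 = 1 then (1 : L) else 0)).Local v)), ∀ γH ∈ V, IsLocalGRegular L v γH →
        ¬ (∃ x : (w.1.adicCompletion L), (((((γH).1.val : GL (Fin 2) (UnitaryGroup.LocalRing L v)).val.map (Pi.evalRingHom (fun w' : UnitaryGroup.PlacesOver L v => w'.1.adicCompletion L) w))).charpoly).IsRoot x) →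
        ∑ᶠ c : ConjClasses ((UnitaryGroup.cmDatum L 3 (Matrix.of fun i j : Fin 3 => if i.val + j.val + 1 = 3 then (1 : L) else 0)).Local v), ((finExplicitCollection L (Matrix.of fun i j : Fin 3 => if i.val + j.val + 1 = 3 then (1 : L) else 0) μ (finExplicitDelta_conj_left_all L (Matrix.of fun i j : Fin 3 => if i.val + j.val + 1 = 3 then (1 : L) else 0) μ) (finExplicitDelta_conj_right_all L (Matrix.of fun i j : Fin 3 => if i.val + j.val + 1 = 3 then (1 : L) else 0) μ)) v).Δ γH (Quotient.out c) * classOrbitalIntegral mG₃ g c =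
          ∑ s, a s * stableOrbitalIntegralRel (IsLocalStablyConjH L v) mH (ψ s) γH) ∧
      (∃ V ∈ 𝓝 (1 : ((UnitaryGroup.cmDatum L 2 (Matrix.of fun i j : Fin 2 => if i.val + j.val + 1 = 2 then (1 : L) else 0)).Local v × (UnitaryGroup.cmDatum L 1 (Matrix.of fun i j : Fin 1 => if i.val + j.val + 1 = 1 then (1 : L) else 0)).Local v)), ∀ γH ∈ V, IsLocalGRegular L v γH →
        (∃ (y : ((UnitaryGroup.cmDatum L 2 (Matrix.of fun i j : Fin 2 => if i.val + j.val + 1 = 2 then (1 : L) else 0)).Local v × (UnitaryGroup.cmDatum L 1 (Matrix.of fun i j : Fin 1 => if i.val + j.val + 1 = 1 then (1 : L) else 0)).Local v)) (d' : Fin 2 → (UnitaryGroup.LocalRing L v)ˣ),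
            glDiagonal 2 (UnitaryGroup.LocalRing L v) d' = ((y * γH * y⁻¹).1.val : GL (Fin 2) (UnitaryGroup.LocalRing L v))) →
        ∑ᶠ c : ConjClasses ((UnitaryGroup.cmDatum L 3 (Matrix.of fun i j : Fin 3 => if i.val + j.val + 1 = 3 then (1 : L) else 0)).Local v), ((finExplicitCollection L (Matrix.of fun i j : Fin 3 => if i.val + j.val + 1 = 3 then (1 : L) else 0) μ (finExplicitDelta_conj_left_all L (Matrix.of fun i j : Fin 3 => if i.val + j.val + 1 = 3 then (1 : L) else 0) μ) (finExplicitDelta_conj_right_all L (Matrix.of fun i j : Fin 3 => if i.val + j.val + 1 = 3 then (1 : L) else 0) μ)) v).Δ γH (Quotient.out c) * classOrbitalIntegral mG₃ g c =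
          ∑ s, a s * stableOrbitalIntegralRel (IsLocalStablyConjH L v) mH (ψ s) γH) := by
  -- (D-G): the census constant `C` of the anchor at this place
  obtain ⟨C, hC⟩ := hDG L w hw _he _h2 ϖ _hϖ νG₃ mG₃ hmG N hN Kt hKt
  -- (D-H): ONE H-side family for all three rows; row (1) law-shaped, rows (2)(3) exported
  obtain ⟨r, ψ, hψ, coef, ⟨VH, hVH, hH⟩, hrow2, hrow3⟩ :=
    hDH L w hw _he _h2 ϖ _hϖ d tE hD δ hδ hδ0 μ hμu hμω νH νG₃ mH mG₃ hmH hmG N hN Kt hKt C hC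
  -- (D-CΔ): four-frame data, norm pairs, relative transfer factor
  obtain ⟨VΔ, hVΔ, hΔ⟩ := hDΔ L w hw _he _h2 ϖ _hϖ d tE hD μ hμu hμω
  refine ⟨r, ψ, hψ, coef, ⟨VH ∩ VΔ, Filter.inter_mem hVH hVΔ, ?_⟩, by rw [hg]; exact hrow2, by rw [hg]; exact hrow3⟩
  intro γH hγ hreg hroot hnotLevi
  obtain ⟨f, hf, a, b, z, ha, hb, hz, hzγ, hra, hrb, ha1, hb1, n₁, n₂, n₃, hE, k, hk, Γ, hΓ, tb, htb, i, B, hB, hNP, hdist, hrel⟩ :=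
    hΔ γH hγ.2 hreg hroot hnotLevi
  -- the right side, from (D-H)
  rw [hH γH hγ.1 hreg f hf a b z ha hb hz hzγ hra hrb ha1 hb1 n₁ n₂ n₃ hE k hk Γ hΓ tb htb i B hB hNP hrel]
  -- the left side: the census dictionary at the four literals
  obtain ⟨hαn, hβn, hαβ, hα1, hβ1, -⟩ := id hE
  have hO : ∀ b', classOrbitalIntegral mG₃ g (ConjClasses.mk (tb b')) = C * (fixedVertexCount (galAdicCompletionMap (L := L) (IsCMField.complexConj L) hw) ϖ tv (Γ b') : ℂ) := by
    intro b'; rw [hg]; exact hC f hf (a * a) (b * b) z hαn hβn hz hαβ hα1 hβ1 b' (Γ b') (hΓ b') (tb b') (htb b')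
  -- `[out c] = c`
  have mk_out : ∀ c : ConjClasses ((UnitaryGroup.cmDatum L 3 (Matrix.of fun i j : Fin 3 => if i.val + j.val + 1 = 3 then (1 : L) else 0)).Local v), ConjClasses.mk (Quotient.out c) = c := fun c => by
    rw [← ConjClasses.quotient_mk_eq_mk]; exact Quotient.out_eq c
  -- the support of the integrand lies in the four norm-pair classes
  have hsupp : Function.support (fun c : ConjClasses ((UnitaryGroup.cmDatum L 3 (Matrix.of fun i j : Fin 3 => if i.val + j.val + 1 = 3 then (1 : L) else 0)).Local v) => ((finExplicitCollection L (Matrix.of fun i j : Fin 3 => if i.val + j.val + 1 = 3 then (1 : L) else 0) μ (finExplicitDelta_conj_left_all L (Matrix.of fun i j : Fin 3 => if i.val + j.val + 1 = 3 then (1 : L) else 0) μ) (finExplicitDelta_conj_right_all L (Matrix.of fun i j : Fin 3 => if i.val + j.val + 1 = 3 then (1 : L) else 0) μ)) v).Δ γH (Quotient.out c) * classOrbitalIntegral mG₃ g c) ⊆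
      ((Finset.univ.image fun b' : Fin 4 => ConjClasses.mk (tb b') : Finset (ConjClasses ((UnitaryGroup.cmDatum L 3 (Matrix.of fun i j : Fin 3 => if i.val + j.val + 1 = 3 then (1 : L) else 0)).Local v))) : Set (ConjClasses ((UnitaryGroup.cmDatum L 3 (Matrix.of fun i j : Fin 3 => if i.val + j.val + 1 = 3 then (1 : L) else 0)).Local v))) := by
    intro c hc
    rw [Function.mem_support] at hc
    have hΔne : ((finExplicitCollection L (Matrix.of fun i j : Fin 3 => if i.val + j.val + 1 = 3 then (1 : L) else 0) μ (finExplicitDelta_conj_left_all L (Matrix.of fun i j : Fin 3 => if i.val + j.val + 1 = 3 then (1 : L) else 0) μ) (finExplicitDelta_conj_right_all L (Matrix.of fun i j : Fin 3 => if i.val + j.val + 1 = 3 then (1 : L) else 0) μ)) v).Δ γH (Quotient.out c) ≠ 0 := left_ne_zero_of_mul hc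
    have hnp : IsLocalNormPair L (Matrix.of fun i j : Fin 3 => if i.val + j.val + 1 = 3 then (1 : L) else 0) v γH (Quotient.out c) := by
      by_contra hn
      exact hΔne ((((finExplicitCollection L (Matrix.of fun i j : Fin 3 => if i.val + j.val + 1 = 3 then (1 : L) else 0) μ (finExplicitDelta_conj_left_all L (Matrix.of fun i j : Fin 3 => if i.val + j.val + 1 = 3 then (1 : L) else 0) μ) (finExplicitDelta_conj_right_all L (Matrix.of fun i j : Fin 3 => if i.val + j.val + 1 = 3 then (1 : L) else 0) μ)) v)).eq_zero_of_not_rel _ _ hn)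
    obtain ⟨b', hb'⟩ := (hNP _).1 hnp
    rw [Finset.coe_image]
    exact ⟨b', Finset.mem_coe.2 (Finset.mem_univ b'), by show ConjClasses.mk (tb b') = c; rw [← hb', mk_out]⟩
  rw [finsum_eq_sum_of_support_subset _ hsupp, Finset.sum_image fun b₁ _ b₂ _ h => hdist b₁ b₂ h]
  -- each term: `Δ(γ_H, out [t_b]) = Δ(γ_H, t_b) = Δ(γ_H, t_{b₀})·κ_i(b)`, `Φ(1_{K_t}, [t_b]) = C·n_t(Γ_b)`
  have hterm : ∀ b' : Fin 4, ((finExplicitCollection L (Matrix.of fun i j : Fin 3 => if i.val + j.val + 1 = 3 then (1 : L) else 0) μ (finExplicitDelta_conj_left_all L (Matrix.of fun i j : Fin 3 => if i.val + j.val + 1 = 3 then (1 : L) else 0) μ) (finExplicitDelta_conj_right_all L (Matrix.of fun i j : Fin 3 => if i.val + j.val + 1 = 3 then (1 : L) else 0) μ)) v).Δ γH (Quotient.out (ConjClasses.mk (tb b'))) * classOrbitalIntegral mG₃ g (ConjClasses.mk (tb b')) =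
      ((finExplicitCollection L (Matrix.of fun i j : Fin 3 => if i.val + j.val + 1 = 3 then (1 : L) else 0) μ (finExplicitDelta_conj_left_all L (Matrix.of fun i j : Fin 3 => if i.val + j.val + 1 = 3 then (1 : L) else 0) μ) (finExplicitDelta_conj_right_all L (Matrix.of fun i j : Fin 3 => if i.val + j.val + 1 = 3 then (1 : L) else 0) μ)) v).Δ γH (tb 0) * C * ((kappaChar i b' : ℂ) * (fixedVertexCount (galAdicCompletionMap (L := L) (IsCMField.complexConj L) hw) ϖ tv (Γ b') : ℂ)) := by
    intro b'
    have hconj : IsConj (tb b') (Quotient.out (ConjClasses.mk (tb b'))) := by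
      rw [← ConjClasses.mk_eq_mk_iff_isConj, mk_out]
    obtain ⟨y, hy⟩ := isConj_iff.1 hconj
    rw [← hy, (((finExplicitCollection L (Matrix.of fun i j : Fin 3 => if i.val + j.val + 1 = 3 then (1 : L) else 0) μ (finExplicitDelta_conj_left_all L (Matrix.of fun i j : Fin 3 => if i.val + j.val + 1 = 3 then (1 : L) else 0) μ) (finExplicitDelta_conj_right_all L (Matrix.of fun i j : Fin 3 => if i.val + j.val + 1 = 3 then (1 : L) else 0) μ)) v)).conj_right, hrel b', hO b']
    ring
  rw [Finset.sum_congr rfl fun b' _ => hterm b', ← Finset.mul_sum]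
  congr 1
  -- (K-SGN) at this datum: the signed value of the κ-weighted four-frame sum
  obtain ⟨h0, h2⟩ := hKS hD f hf δ hδ hδ0 a b ha hb ha1 hb1 n₁ n₂ n₃ hE Γ hΓ k hk i B hB
  rcases htv with rfl | rfl
  · rw [if_pos rfl]
    have h' := congrArg (fun x : ℚ => (x : ℂ)) h0
    push_cast at h' ⊢
    exact h'
  · rw [if_neg (by decide)]
    have h' := congrArg (fun x : ℚ => (x : ℂ)) h2
    push_cast at h' ⊢
    exact h'

end Summit.HodgeConjecture.HodgeConjecture.Cruxes.H413.F0P3cDyRamAnchorRowsOfFourFrameLawsR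

end
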